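import Summits.Ventures.HodgeRepro2.T5SU11SphericalXiLog

/-!
# Harish-Chandra's `c`-function of `SU(1,1)`: continuity on `(-∞, 1)`, the blow-up
`c(λ) ≥ 1/(π (1 - λ)) → ∞` as `λ → 1⁻`, and `c(λ) → 0` as `λ → -∞`

For `cfun λ = (2π)⁻¹ ∫_{-π}^{π} cLimit λ φ dφ`, `cLimit λ φ = ((1 - cos φ)/2)^{-λ/2}`
(`T5SU11SphericalAsymptotic`): the integrand is measurable (`measurable_cLimit`) and, off `φ = 0`,
continuous in `λ` (`continuous_cLimit_param`); on `λ ≤ λ₁ < 1` it is dominated by the integrable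
`cLimit λ₁` (`T5SU11SphericalCfun.cLimit_mono`), so **`c` is continuous at every `λ₀ < 1`**
(`continuousAt_cfun`, `intervalIntegral.continuousAt_of_dominated_interval` with `λ₁ = (λ₀ + 1)/2`)
and **continuous on `(-∞, 1)`** (`continuousOn_cfun`). For `0 ≤ λ < 1` the comparison
`|sin(φ/2)| ≤ |φ/2| ≤ |φ|` gives `|φ|^{-λ} ≤ cLimit λ φ` (`abs_rpow_neg_le_cLimit`) and
`∫_{-π}^{π} |φ|^{-λ} dφ = 2 π^{1-λ}/(1 - λ)` (`integral_abs_rpow_neg`, `integral_rpow`), hence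
**`c(λ) ≥ 1/(π (1 - λ))`** (`inv_le_cfun`) and **`c(λ) → ∞` as `λ → 1⁻`** (`tendsto_cfun_nhdsLT_one`):
the leading coefficient of `φ_λ(a_t) ~ c(λ) e^{-λt}` blows up at the critical parameter `λ = ρ = 1`,
where the logarithmic estimate of `T5SU11SphericalXiLog` takes over. At the other end the
integrand tends to `0` for `φ ∈ (-π, π) ∖ {0}` (the base lies in `(0, 1)`, `tendsto_cLimit_atBot`) under
the bound `1` (`cLimit_le_one`), so **`c(λ) → 0` as `λ → -∞`** (`tendsto_cfun_atBot`). Together with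
`T5SU11SphericalCfun` (`c > 0`, monotone, `c(0) = 1`, `c ≤ 1` on `λ ≤ 0`, `c ≥ 1` on `[0, 1)`): `c` is a
continuous monotone bijection-candidate `(-∞, 1) → (0, ∞)`. Nothing is claimed about (N).

Blind lane: Mathlib + the HodgeRepro2 prefix only; no sorry; axioms ⊆ {propext, Classical.choice,
Quot.sound}.
-/

namespace Summit.Ventures.HodgeRepro2.T5SU11SphericalCfunLimit

open MeasureTheory Metric Set Filter Topology Complex intervalIntegral
open T5SU11Unimodular T5SU11Fibration T5SU11Cartan T5SU11OneParameter T5SU11CartanProjection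
  T5HaarCircle T5BergmanCoefficient T5SU11SphericalFunction T5SU11SphericalTwo
  T5SU11SphericalSymmetry T5SU11SphericalBounds T5SU11SphericalContinuous
  T5SU11SphericalAsymptotic T5SU11SphericalLp T5SU11SphericalCfun T5SU11SphericalLpSharp
  T5SU11SphericalXiLog
open scoped Real

/-! ### The limit integrand: measurability and continuity in the parameter -/

/-- `cLimit λ` is measurable. -/
lemma measurable_cLimit (lam : ℝ) : Measurable (cLimit lam) := by
  unfold cLimit
  exact Measurable.pow_const (by fun_prop) _

/-- For `φ ∈ [-π, π]`, `φ ≠ 0`, the map `λ ↦ cLimit λ φ` is continuous. -/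
lemma continuous_cLimit_param {φ : ℝ} (h1 : -π ≤ φ) (h2 : φ ≤ π) (hφ : φ ≠ 0) :
    Continuous fun lam : ℝ => cLimit lam φ := by
  have hb : 0 < (1 - Real.cos φ) / 2 := by linarith [cos_lt_one_of_ne_zero h1 h2 hφ]
  unfold cLimit
  exact continuous_const.rpow (by fun_prop) fun _ => Or.inl hb.ne'

/-- Almost every real number is different from `π`. -/
lemma ae_ne_pi : ∀ᵐ φ ∂(volume : Measure ℝ), φ ≠ π := by
  rw [ae_iff]
  simp only [not_not, Set.setOf_eq_eq_singleton]
  exact Real.volume_singleton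

/-! ### Continuity of `c` on `(-∞, 1)` -/

/-- **`c` is continuous at every `λ₀ < 1`** (dominated convergence with the bound `cLimit ((λ₀+1)/2)`). -/
theorem continuousAt_cfun {l₀ : ℝ} (hl : l₀ < 1) : ContinuousAt cfun l₀ := by
  have hπ := Real.pi_pos
  have hl₁ : (l₀ + 1) / 2 < 1 := by linarith
  have hl₀₁ : l₀ < (l₀ + 1) / 2 := by linarith
  have hcont : ContinuousAt (fun l : ℝ => ∫ φ in (-π)..π, cLimit l φ) l₀ := by
    refine continuousAt_of_dominated_interval (bound := cLimit ((l₀ + 1) / 2)) ?_ ?_ ?_ ?_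
    · exact Filter.Eventually.of_forall fun l => (measurable_cLimit l).aestronglyMeasurable
    · filter_upwards [Iio_mem_nhds hl₀₁] with l hl'
      filter_upwards [ae_ne_zero] with φ hφ hmem
      rw [uIoc_of_le (by linarith), mem_Ioc] at hmem
      rw [Real.norm_eq_abs, abs_of_nonneg (cLimit_nonneg _ _)]
      exact cLimit_mono (Set.mem_Iio.mp hl').le hmem.1.le hmem.2 hφ
    · exact intervalIntegrable_cLimit hl₁
    · filter_upwards [ae_ne_zero] with φ hφ hmem
      rw [uIoc_of_le (by linarith), mem_Ioc] at hmem
      exact (continuous_cLimit_param hmem.1.le hmem.2 hφ).continuousAt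
  exact continuousAt_const.mul hcont

/-- **`c` is continuous on `(-∞, 1)`.** -/
theorem continuousOn_cfun : ContinuousOn cfun (Iio 1) :=
  fun _ hl => (continuousAt_cfun (Set.mem_Iio.mp hl)).continuousWithinAt

/-! ### The blow-up at `λ = 1` -/

/-- `|φ|^{-λ} ≤ cLimit λ φ` for `λ ≥ 0` and `φ ∈ [-π, π]`, `φ ≠ 0` (from `|sin(φ/2)| ≤ |φ|/2 ≤ |φ|`). -/
lemma abs_rpow_neg_le_cLimit {lam : ℝ} (hlam : 0 ≤ lam) {φ : ℝ} (h1 : -π ≤ φ) (h2 : φ ≤ π)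
    (hφ : φ ≠ 0) : |φ| ^ (-lam) ≤ cLimit lam φ := by
  have hφpos : 0 < |φ| := abs_pos.mpr hφ
  have hsin : 0 < Real.sin (φ / 2) ^ 2 := by
    rw [← one_sub_cos_div_two]
    linarith [cos_lt_one_of_ne_zero h1 h2 hφ]
  have hs : Real.sin (φ / 2) ^ 2 ≤ (|φ| / 2) ^ 2 := by
    have := Real.sin_sq_le_sq (x := φ / 2)
    rwa [show (φ / 2) ^ 2 = (|φ| / 2) ^ 2 by rw [div_pow, div_pow, sq_abs]] at this
  unfold cLimit
  rw [one_sub_cos_div_two]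
  calc |φ| ^ (-lam) ≤ (|φ| / 2) ^ (-lam) :=
        Real.rpow_le_rpow_of_nonpos (by positivity) (by linarith) (by linarith)
    _ = ((|φ| / 2) ^ 2) ^ (-lam / 2) := by
        rw [← Real.rpow_natCast, ← Real.rpow_mul (by positivity)]
        congr 1
        push_cast
        ring
    _ ≤ (Real.sin (φ / 2) ^ 2) ^ (-lam / 2) :=
        Real.rpow_le_rpow_of_nonpos hsin hs (by linarith)

/-- `∫_{-π}^{π} |φ|^{-λ} dφ = 2 π^{1-λ}/(1 - λ)` for `λ < 1`. -/
lemma integral_abs_rpow_neg {lam : ℝ} (hlam : lam < 1) :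
    ∫ φ in (-π)..π, |φ| ^ (-lam) = 2 * (π ^ (1 - lam) / (1 - lam)) := by
  have hπ := Real.pi_pos
  rw [integral_symm_of_even (fun x => by simp only [abs_neg]) hπ.le
    (intervalIntegrable_abs_rpow (by linarith) hπ.le)]
  congr 1
  have h : ∫ φ in (0 : ℝ)..π, |φ| ^ (-lam) = ∫ φ in (0 : ℝ)..π, φ ^ (-lam) := by
    refine integral_congr fun φ hφ => ?_
    rw [uIcc_of_le hπ.le] at hφ
    simp only [abs_of_nonneg hφ.1]
  rw [h, integral_rpow (Or.inl (by linarith)), Real.zero_rpow (ne_of_gt (by linarith)), sub_zero,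
    show -lam + 1 = 1 - lam by ring]

/-- **The lower bound** `1/(π (1 - λ)) ≤ c(λ)` for `0 ≤ λ < 1`. -/
theorem inv_le_cfun {lam : ℝ} (h0 : 0 ≤ lam) (h1 : lam < 1) : (π * (1 - lam))⁻¹ ≤ cfun lam := by
  have hπ := Real.pi_pos
  have h1' : 0 < 1 - lam := by linarith
  have hint : ∫ φ in (-π)..π, |φ| ^ (-lam) ≤ ∫ φ in (-π)..π, cLimit lam φ := by
    refine integral_mono_ae_restrict (by linarith)
      (intervalIntegrable_abs_rpow (by linarith) hπ.le) (intervalIntegrable_cLimit h1) ?_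
    rw [Filter.EventuallyLE, ae_restrict_iff' measurableSet_Icc]
    filter_upwards [ae_ne_zero] with φ hφ hmem
    exact abs_rpow_neg_le_cLimit h0 hmem.1 hmem.2 hφ
  rw [integral_abs_rpow_neg h1] at hint
  have hpow : 1 ≤ π ^ (1 - lam) := Real.one_le_rpow (by linarith [Real.pi_gt_three]) h1'.le
  unfold cfun
  calc (π * (1 - lam))⁻¹ = (2 * π)⁻¹ * (2 * (1 / (1 - lam))) := by rw [mul_inv]; ring
    _ ≤ (2 * π)⁻¹ * (2 * (π ^ (1 - lam) / (1 - lam))) :=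
        mul_le_mul_of_nonneg_left
          (mul_le_mul_of_nonneg_left (div_le_div_of_nonneg_right hpow h1'.le) (by norm_num))
          (by positivity)
    _ ≤ (2 * π)⁻¹ * ∫ φ in (-π)..π, cLimit lam φ :=
        mul_le_mul_of_nonneg_left hint (by positivity)

/-- **`c(λ) → ∞` as `λ → 1⁻`.** -/
theorem tendsto_cfun_nhdsLT_one : Tendsto cfun (𝓝[<] 1) atTop := by
  have hπ := Real.pi_pos
  have h1 : Tendsto (fun lam : ℝ => π * (1 - lam)) (𝓝[<] 1) (𝓝[>] 0) := by
    rw [tendsto_nhdsWithin_iff]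
    constructor
    · have h : Tendsto (fun lam : ℝ => π * (1 - lam)) (𝓝 1) (𝓝 (π * (1 - 1))) :=
        (continuous_const.mul (continuous_const.sub continuous_id)).tendsto 1
      rw [sub_self, mul_zero] at h
      exact tendsto_nhdsWithin_of_tendsto_nhds h
    · exact eventually_nhdsWithin_of_forall fun lam hlam =>
        mul_pos hπ (sub_pos.mpr (Set.mem_Iio.mp hlam))
  have h2 : Tendsto (fun lam : ℝ => (π * (1 - lam))⁻¹) (𝓝[<] 1) atTop :=
    tendsto_inv_nhdsGT_zero.comp h1
  refine tendsto_atTop_mono' _ ?_ h2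
  filter_upwards [Ico_mem_nhdsLT (zero_lt_one : (0 : ℝ) < 1)] with lam hlam
  exact inv_le_cfun hlam.1 hlam.2

/-! ### The limit `c(λ) → 0` as `λ → -∞` -/

/-- For `φ ∈ (-π, π)`, `φ ≠ 0`: `cLimit λ φ → 0` as `λ → -∞` (the base lies in `(0, 1)`). -/
lemma tendsto_cLimit_atBot {φ : ℝ} (h1 : -π < φ) (h2 : φ < π) (hφ : φ ≠ 0) :
    Tendsto (fun lam : ℝ => cLimit lam φ) atBot (𝓝 0) := by
  have hb0 : 0 < (1 - Real.cos φ) / 2 := by linarith [cos_lt_one_of_ne_zero h1.le h2.le hφ]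
  have hb1 : (1 - Real.cos φ) / 2 < 1 := by
    rw [one_sub_cos_div_two, Real.sin_sq]
    have hc := Real.cos_pos_of_mem_Ioo (x := φ / 2) ⟨by linarith, by linarith⟩
    have := pow_pos hc 2
    linarith
  have hexp : Tendsto (fun lam : ℝ => -lam / 2) atBot atTop :=
    tendsto_neg_atBot_atTop.atTop_div_const (by norm_num)
  unfold cLimit
  exact (tendsto_rpow_atTop_of_base_lt_one _ (by linarith) hb1).comp hexp

/-- **`c(λ) → 0` as `λ → -∞`** (dominated convergence with the bound `1` on `λ ≤ 0`). -/
theorem tendsto_cfun_atBot : Tendsto cfun atBot (𝓝 0) := by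
  have hπ := Real.pi_pos
  have hDCT : Tendsto (fun lam : ℝ => ∫ φ in (-π)..π, cLimit lam φ) atBot
      (𝓝 (∫ φ in (-π)..π, (0 : ℝ))) := by
    refine tendsto_integral_filter_of_dominated_convergence (fun _ => (1 : ℝ)) ?_ ?_ ?_ ?_
    · exact Filter.Eventually.of_forall fun lam => (measurable_cLimit lam).aestronglyMeasurable
    · filter_upwards [Filter.eventually_le_atBot 0] with lam hlam
      refine Filter.Eventually.of_forall fun φ _ => ?_
      rw [Real.norm_eq_abs, abs_of_nonneg (cLimit_nonneg _ _)]
      exact cLimit_le_one hlam φ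
    · exact intervalIntegrable_const
    · filter_upwards [ae_ne_zero, ae_ne_pi] with φ hφ hφπ hmem
      rw [uIoc_of_le (by linarith), mem_Ioc] at hmem
      exact tendsto_cLimit_atBot hmem.1 (lt_of_le_of_ne hmem.2 hφπ) hφ
  have h := hDCT.const_mul (2 * π)⁻¹
  simp only [intervalIntegral.integral_zero, mul_zero] at h
  exact h

end Summit.Ventures.HodgeRepro2.T5SU11SphericalCfunLimit
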